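import Summits.NavierStokesRegularity.NavierStokesRegularity.Theses.TypeICertificateLadder
import Literature.Analysis.FluidPDE.OseenDuhamelLowFrequency
import Literature.Analysis.FluidPDE.NSLerayBlowupRateTopHolds
import Literature.Analysis.FluidPDE.NSCriticalClosureProofs
import Literature.Analysis.FluidPDE.TaoLocalisationHolds
import HarnessLib

/-!
# Line `oseen-tail-calm-core-confinement` — crux `TypeICertificateLadder.TypeIConcentration`
# (item stmt-NavierStokesRegularity-2881, route TypeICertificateLadder, rank 4)

CRUX-PLAN skeleton (planner-cruxplan-stmt-NavierStokesRegularity-2881-oseen-tail-calm-core-0,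
2026-08-16), merging idea card `oseen-tail-calm-core-confinement` (ideator 2) with the
triage-preferred explicit formulation of its twin `receding-shield-leray-tracking` (ideator 3;
TRIAGE-r1-1/2/3: "same lever … keep C's fixed-ball statement").

THE CRUX (verbatim, `Theses/TypeICertificateLadder.lean`): for every Type-I constant `C` there are
`ρ, γ > 0` depending on `C` ONLY such that every classical Leray–Hopf solution on `ℝ³ × [0,T)`
from a rapidly decaying datum with the eventual rate `√(T-t)‖u(t,x)‖ ≤ C√ν` and NO smooth
extension past `T` has a FIXED centre `x₀` with `γν³ ≤ ∫_{B(x₀, ρ√(ν(T-t)))} ‖u(t)‖³` for all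
`t < T` near `T`.

THE LINE (six registered stubs, composition `TypeIConcentration_of` kernel-checked, no sorry of
its own):

* `stub_oseenMajorantTail` (S5, support of S1) — the Oseen-kernel TAIL: `∫_{‖z‖ ≥ D} k(σ,z) dz ≤ K/D`
  uniformly in the parabolic time `σ` (`k = oseenMajorant`, Koch–Tataru (14); `= 4πC_K/D`).
* `stub_shieldIntegral` (S6, support of S1) — the scalar SHIELD functional
  `Φ_{m,K}(λ) = ∫_1^∞ w⁻¹ min(m/√(w-1), K/(λ(√w-1))) dw → 0` as `λ → ∞` (dominated convergence;
  numerically `λΦ(λ) ≈ 21 + 16π log λ`, kit jobs j005575/j006964/j007028 of the ideator/triagers).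
* `stub_calmCoresPersist` (S1, LOAD-BEARING, the lead's stub) — PROP M / NO-NUCLEATION in the
  fixed-ball form: `S5 → S6 →` there is a universal `c₀ > 0` such that for all `C > 0`,
  `0 < c ≤ c₀` there is `ρ = ρ(C,c) ≥ 1` with: under the pointwise envelope
  `√(T-s)‖u(s,x)‖ ≤ C√ν` on `[t₁,T) × ℝ³`, if `u(t₁)` is `c`-quiet on `B̄(x₀, ρ√(ν(T-t₁)))` then
  `√(T-s)‖u(s,y)‖ ≤ 4c√ν` for all `s ∈ [t₁,T)`, `y ∈ B̄(x₀, √(ν(T-t₁)))`. Proof route: first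
  touching time of the receding control region `B̄(x₀, √(ν(T-t₁)) + λ√(ν(T-s)))` in the Oseen
  mild formula from `t₁` (DATA `1.5c` by the Gaussian leak, INSIDE `16π m c² ≤ c/2`, OUTSIDE
  `C²Φ(λ) ≤ c/4`).
* `stub_gradientUnderEnvelope` (S2) — KNSS (4.6), `k = 1`: `(T-t)‖∇u(t,x)‖ ≤ C₁(C)` on the later
  half of an envelope window (`IsKNSSDriftMild.exists_gradient_bound`, window `N²(t-s) ≤ ν`).
* `stub_loudSetBounded` (S3) — an `L²` field with bounded derivative has bounded super-level sets
  (far-field smallness of the slice `u(t₂)`; pins the loud sequence).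
* `stub_loudPointMass` (S4) — a `c`-loud point plus the gradient bound gives `L³` mass
  `|B₁| c⁶/(64 C₁³) · ν³` on the ball of radius `(c/(2C₁))√(ν(T-t))` about it (mean value).

COMPOSITION (`TypeIConcentration_of`, proved here): onset `tm` of the rate, `t₁ = (tm+T)/2`,
`t₂ = (t₁+T)/2`; Leray's floor (`leray_blowup_rate_top_holds`, sub-strip boundedness by
`eLpNorm_uncurry_top_lt_top_of_tao2011` — the ONE use of `¬ HasSmoothExtensionPast`, exactly as in
the proved `RungZero`) gives `(c_L/2)`-loud points `y_n` at times `s_n ↑ T`; with `16c ≤ c_L` the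
contrapositive of S1 confines them: `y_n` is within `ρ√(ν(T-t))` of a `c`-loud point of `u(t)` for
every `t ∈ (t₂, s_n]`, and within `ρ√(ν(T-t₂))` of the bounded (S3 + S2 + `IsLerayHopfOn.memLp`)
`c`-loud set of `u(t₂)`; Bolzano–Weierstrass + nearest points in closed sets
(`exists_centre_of_confinement`, pure topology, proved here) pin ONE centre `x₀` with a `c`-loud
point within `ρ√(ν(T-t))` at EVERY `t ∈ (t₂,T)`; S4 + S2 + ball inclusion give the crux with
`ρ_crux = ρ + c/(2C₁)`, `γ = |B₁| c⁶/(64C₁³)`, `c = min c₀ (c_L/16)`.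

DISPROOF USED (`Cruxes/TypeIConcentration/Disproof.lean`, gen 2 v3): `¬HasSmoothExtensionPast` is
spent once (Leray floor) — honours `typeIConcentration_false_without_noExtension`;
`IsLerayHopfOn` is spent in S1 (mild representation: the ODE flow of
`typeIConcentration_false_without_LerayHopf` nucleates and is NOT Oseen-mild) and in S3
(`memLp`); `(ρ_crux, γ)` respect `no_witness_above_rate_ceiling` (`γ ∝ c⁶/C₁³ ≪ |B₁|ρ³C³`);
`ρ = O(C² log(C/c)/c) ≥ C` matches §(c). No landed `Theorems/…/Negative` lemma exists for this
crux (checked 2026-08-16), so none is imported.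
-/

noncomputable section

set_option linter.dupNamespace false

namespace Summit.NavierStokesRegularity.NavierStokesRegularity.Cruxes.TypeIConcentration.OseenTailCalmCoreConfinement

open MeasureTheory Set Filter Topology Metric Function
open Literature.Analysis.FluidPDE
open scoped ENNReal NNReal

/-! ## The six registered stubs (sorries live ONLY here) -/

/-- **S5 · `stub_oseenMajorantTail` (support of S1; S/M).** The TAIL of the parabolic majorant
`k(σ,z) = C_K (σ + ‖z‖²)^{-2}` of the Oseen–Koch–Tataru kernel on `ℝ³` beyond radius `D` is
`≤ K/D`, uniformly in `σ > 0` (`k ≤ C_K‖z‖⁻⁴`, `∫_{‖z‖≥D}‖z‖⁻⁴ dz = 4π/D`; polar coordinates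
`MeasureTheory.integral_fun_norm_addHaar`). Leans on: `oseenMajorant`, `oseenKernelBoundConst_pos`,
`integrable_oseenMajorant` (OseenDuhamelLowFrequency.lean). -/
theorem stub_oseenMajorantTail :
    ∃ K : ℝ, 0 < K ∧ ∀ σ : ℝ, 0 < σ → ∀ D : ℝ, 0 < D →
      ∫ z in {z : EuclideanSpace ℝ (Fin 3) | D ≤ ‖z‖},
          Literature.Analysis.FluidPDE.oseenMajorant (EuclideanSpace ℝ (Fin 3)) σ z ≤ K / D := by
  sorry

/-- **S6 · `stub_shieldIntegral` (support of S1; S/M).** The scalar SHIELD functional of the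
receding control region, `Φ_{m,K}(λ) = ∫_{(1,∞)} w⁻¹ · min(m/√(w-1), K/(λ(√w-1))) dw`, is finite
for `λ > 0` (integrand `O((w-1)^{-1/2})` at `1`, `O(w^{-3/2})` at `∞`) and tends to `0` as
`λ → ∞` (dominated convergence; quantitatively `O(log λ/λ)`, `λΦ ≈ 21 + 16π log λ` for `m = π²`,
`K = 4π`: kit jobs j005575, j006964, j007028). Pure real analysis. -/
theorem stub_shieldIntegral :
    ∀ (m K ε : ℝ), 0 < m → 0 < K → 0 < ε → ∃ Λ : ℝ, 0 < Λ ∧ ∀ lam : ℝ, Λ ≤ lam →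
      MeasureTheory.IntegrableOn
          (fun w : ℝ => w⁻¹ * min (m / Real.sqrt (w - 1)) (K / (lam * (Real.sqrt w - 1))))
          (Set.Ioi (1 : ℝ)) MeasureTheory.volume ∧
        ∫ w in Set.Ioi (1 : ℝ), w⁻¹ * min (m / Real.sqrt (w - 1)) (K / (lam * (Real.sqrt w - 1))) ≤ ε := by
  sorry

/-- **S1 · `stub_calmCoresPersist` (LOAD-BEARING, XL; the lead's stub).** PROP M / NO-NUCLEATION,
fixed-ball form, GIVEN the two analytic inputs S5 (kernel tail) and S6 (shield functional): there
is a universal `c₀ > 0` (`c₀ = 1/(32π m)`, `m = oseenMajorantMass ℝ³`) such that for every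
Type-I constant `C > 0` and every `0 < c ≤ c₀` there is a similarity radius `ρ = ρ(C,c) ≥ 1`
(`ρ = 1 + λ + margin`, `λ` from S6 with `ε = c/(4C²)`, margin from the Gaussian leak
`C·P(|N(0,2I₃)| ≥ margin) ≤ c/2`) with: for a classical solution on `[0,T)`, Leray–Hopf from its
rapidly decaying datum, obeying the pointwise ENVELOPE `√(T-s)‖u(s,x)‖ ≤ C√ν` on `[t₁,T) × ℝ³`,
if `u(t₁)` is `c`-QUIET on `B̄(x₀, ρ√(ν(T-t₁)))` then `√(T-s)‖u(s,y)‖ ≤ 4c√ν` for all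
`s ∈ [t₁,T)` and `y ∈ B̄(x₀, √(ν(T-t₁)))`. Proof route (TRIAGE-r1-2/3, re-derived term by term):
first touching time `s*` of `F(s) = max over B̄(x₀, √(ν(T-t₁)) + λ√(ν(T-s)))` of `√(T-s)‖u(s,·)‖`
with the level `4c√ν`, in the Oseen mild formula from `t₁`
(`isMildNSSolutionOn_of_isLerayHopfOn_holds`, `ae_eq_heatExtension_sub_oseenDuhamel_of_isMildNSSolutionOn`,
`oseenMild_restart_holds`, sub-strip bound `exists_forall_norm_le_of_tao2011`): DATA `≤ 1.5c`,
INSIDE `≤ 16π m c² ≤ c/2` (`∫ k(θ,·) = m θ^{-1/2}`, `∫_{t₁}^{s} dσ/((T-σ)√(s-σ)) ≤ π/√(T-s)`),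
OUTSIDE `≤ C²Φ(λ) ≤ c/4` (distance `≥ λ√ν(√(T-σ)-√(T-s*))` to the exterior, S5, then the
substitution `w = (T-σ)/(T-s*)` gives S6's functional) — total `2.25c < 4c`. The Leray–Hopf
hypothesis is essential (Disproof.lean §4: the ODE flow nucleates). -/
theorem stub_calmCoresPersist :
    (∃ K : ℝ, 0 < K ∧ ∀ σ : ℝ, 0 < σ → ∀ D : ℝ, 0 < D →
      ∫ z in {z : EuclideanSpace ℝ (Fin 3) | D ≤ ‖z‖},
          Literature.Analysis.FluidPDE.oseenMajorant (EuclideanSpace ℝ (Fin 3)) σ z ≤ K / D) →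
    (∀ (m K ε : ℝ), 0 < m → 0 < K → 0 < ε → ∃ Λ : ℝ, 0 < Λ ∧ ∀ lam : ℝ, Λ ≤ lam →
      MeasureTheory.IntegrableOn
          (fun w : ℝ => w⁻¹ * min (m / Real.sqrt (w - 1)) (K / (lam * (Real.sqrt w - 1))))
          (Set.Ioi (1 : ℝ)) MeasureTheory.volume ∧
        ∫ w in Set.Ioi (1 : ℝ), w⁻¹ * min (m / Real.sqrt (w - 1)) (K / (lam * (Real.sqrt w - 1))) ≤ ε) →
    ∃ c₀ : ℝ, 0 < c₀ ∧ ∀ C : ℝ, 0 < C → ∀ c : ℝ, 0 < c → c ≤ c₀ → ∃ ρ : ℝ, 1 ≤ ρ ∧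
      ∀ (ν T t₁ : ℝ), 0 < ν → 0 < T → 0 ≤ t₁ → t₁ < T →
      ∀ (u : ℝ → EuclideanSpace ℝ (Fin 3) → EuclideanSpace ℝ (Fin 3))
        (p : ℝ → EuclideanSpace ℝ (Fin 3) → ℝ),
        Literature.Analysis.FluidPDE.IsClassicalNSSolutionOn (Set.Ico 0 T) ν 0 u p →
        Literature.Analysis.FluidPDE.IsLerayHopfOn T ν 0 (u 0) u →
        Literature.Analysis.FluidPDE.HasRapidSpatialDecay (u 0) →
        (∀ s ∈ Set.Ico t₁ T, ∀ x, Real.sqrt (T - s) * ‖u s x‖ ≤ C * Real.sqrt ν) →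
        ∀ x₀ : EuclideanSpace ℝ (Fin 3),
          (∀ y ∈ Metric.closedBall x₀ (ρ * Real.sqrt (ν * (T - t₁))),
              Real.sqrt (T - t₁) * ‖u t₁ y‖ ≤ c * Real.sqrt ν) →
          ∀ s ∈ Set.Ico t₁ T, ∀ y ∈ Metric.closedBall x₀ (Real.sqrt (ν * (T - t₁))),
            Real.sqrt (T - s) * ‖u s y‖ ≤ 4 * c * Real.sqrt ν := by
  sorry

/-- **S2 · `stub_gradientUnderEnvelope` (M/L).** GRADIENT UNDER THE ENVELOPE (KNSS 2009, Prop. 4.1,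
(4.6) with `k = 1`, `l = 0`): for every `C` there is `C₁ = C₁(C)` (`= C_K·C·max(1,C)`) such that
under the pointwise envelope on `[t₁,T) × ℝ³` the velocity gradient obeys
`(T-t)‖∇u(t,x)‖ ≤ C₁` for `t ∈ ((t₁+T)/2, T)` (window `[t - θ(T-t), t] ⊆ [t₁,T)`,
`θ = min(1, C⁻²)`, where `N² θ(T-t)/ν ≤ 1` with `N = C√ν/√(T-t)`). Leans on:
`IsKNSSDriftMild.exists_gradient_bound` (KNSSMildGradientBound.lean, PROVED) /
`knss2009_smoothing_holds`, identification of `u` with the bounded Oseen-mild field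
(`oseenMild_bounded_unique`, `isMildNSSolutionOn_of_isLerayHopfOn_holds`), viscosity/time rescaling. -/
theorem stub_gradientUnderEnvelope :
    ∀ C : ℝ, 0 < C → ∃ C₁ : ℝ, 0 < C₁ ∧
      ∀ (ν T t₁ : ℝ), 0 < ν → 0 < T → 0 ≤ t₁ → t₁ < T →
      ∀ (u : ℝ → EuclideanSpace ℝ (Fin 3) → EuclideanSpace ℝ (Fin 3))
        (p : ℝ → EuclideanSpace ℝ (Fin 3) → ℝ),
        Literature.Analysis.FluidPDE.IsClassicalNSSolutionOn (Set.Ico 0 T) ν 0 u p →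
        Literature.Analysis.FluidPDE.IsLerayHopfOn T ν 0 (u 0) u →
        Literature.Analysis.FluidPDE.HasRapidSpatialDecay (u 0) →
        (∀ s ∈ Set.Ico t₁ T, ∀ x, Real.sqrt (T - s) * ‖u s x‖ ≤ C * Real.sqrt ν) →
        ∀ t ∈ Set.Ioo ((t₁ + T) / 2) T, ∀ x : EuclideanSpace ℝ (Fin 3),
          (T - t) * ‖fderiv ℝ (u t) x‖ ≤ C₁ := by
  sorry

/-- **S3 · `stub_loudSetBounded` (S/M).** An `L²` vector field on `ℝ³` with bounded derivative is
small at infinity: its super-level sets `{a ≤ ‖v‖}`, `a > 0`, are bounded (if `‖v(yₙ)‖ ≥ a` with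
`‖yₙ‖ → ∞`, the balls `B(yₙ, a/(2L))` carry `L²`-mass `≥ (a/2)²|B(0,a/(2L))|` each, against
`∫_{‖x‖ ≥ R}‖v‖² → 0`). Used at ONE time `t₂` to bound the loud sequence (TRIAGE-r1-1 sharpening
of the pinning step). Pure real analysis. -/
theorem stub_loudSetBounded :
    ∀ (v : EuclideanSpace ℝ (Fin 3) → EuclideanSpace ℝ (Fin 3)) (L a : ℝ), 0 < a →
      Differentiable ℝ v → (∀ x, ‖fderiv ℝ v x‖ ≤ L) →
      MeasureTheory.MemLp v 2 MeasureTheory.volume →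
      ∃ R : ℝ, ∀ y : EuclideanSpace ℝ (Fin 3), a ≤ ‖v y‖ → ‖y‖ ≤ R := by
  sorry

/-- **S4 · `stub_loudPointMass` (S/M).** LOUD POINT ⇒ MASS: if `(T-t)‖∇v‖ ≤ C₁` everywhere and
`√(T-t)‖v(y)‖ ≥ c√ν`, then `‖v‖ ≥ c√ν/(2√(T-t))` on the ball of radius `(c/(2C₁))√(ν(T-t))`
about `y` (mean value inequality on the convex ball), whence
`∫_{B(y,(c/(2C₁))√(ν(T-t)))} ‖v‖³ ≥ |B₁| · c⁶/(64 C₁³) · ν³` (`|B₁| = volume (ball 0 1)`,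
`Measure.addHaar_ball`). Pure calculus (`Convex.norm_image_sub_le_of_norm_fderiv_le`,
`norm_setIntegral_le_of_norm_le_const` pattern reversed via `setIntegral_mono`). -/
theorem stub_loudPointMass :
    ∀ (c C₁ ν T t : ℝ), 0 < c → 0 < C₁ → 0 < ν → t < T →
      ∀ v : EuclideanSpace ℝ (Fin 3) → EuclideanSpace ℝ (Fin 3), Differentiable ℝ v →
        (∀ x, (T - t) * ‖fderiv ℝ v x‖ ≤ C₁) →
        ∀ y : EuclideanSpace ℝ (Fin 3), c * Real.sqrt ν ≤ Real.sqrt (T - t) * ‖v y‖ →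
          (MeasureTheory.volume (Metric.ball (0 : EuclideanSpace ℝ (Fin 3)) 1)).toReal *
                (c ^ 6 / (64 * C₁ ^ 3)) * ν ^ 3 ≤
            ∫ x in Metric.ball y (c / (2 * C₁) * Real.sqrt (ν * (T - t))), ‖v x‖ ^ 3 := by
  sorry

/-! ## Glue proved here (no sorry): the point-set core of the Leray-floor tracking -/

/-- **Tracking lemma** (pure topology; the `loud_tracking` of TRIAGE-r1-3 re-proved). In a proper
metric space let `y : ℕ → X` be a bounded sequence attached to times `s n → T`, and suppose that
for every `t ∈ (t₂, T)` and every `n` with `t ≤ s n` some point of the closed set `L t` lies within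
`r t` of `y n`. Then ONE point `x₀` (a cluster point of `y`) has, for every `t ∈ (t₂,T)`, a point of
`L t` within `r t`. -/
theorem exists_centre_of_confinement {X : Type*} [MetricSpace X] [ProperSpace X]
    {t₂ T : ℝ} {s : ℕ → ℝ} (hs : Tendsto s atTop (𝓝 T)) {y : ℕ → X} {z : X} {R₀ : ℝ}
    (hy : ∀ n, y n ∈ closedBall z R₀) (L : ℝ → Set X) (hL : ∀ t ∈ Ioo t₂ T, IsClosed (L t))
    (r : ℝ → ℝ)
    (hconf : ∀ t ∈ Ioo t₂ T, ∀ n, t ≤ s n → ∃ w ∈ L t, dist w (y n) ≤ r t) :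
    ∃ x₀ : X, ∀ t ∈ Ioo t₂ T, ∃ w ∈ L t, dist w x₀ ≤ r t := by
  obtain ⟨x₀, -, φ, hφ, hlim⟩ := tendsto_subseq_of_bounded (isBounded_closedBall (x := z) (r := R₀)) hy
  refine ⟨x₀, fun t ht => ?_⟩
  have h1 : ∀ᶠ n in atTop, t ≤ s (φ n) :=
    ((hs.comp hφ.tendsto_atTop).eventually (lt_mem_nhds ht.2)).mono fun n hn => le_of_lt hn
  -- points of `L t` arbitrarily close to distance `r t` from `x₀`
  have hnear : ∀ ε : ℝ, 0 < ε → ∃ w ∈ L t, dist x₀ w < r t + ε := by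
    intro ε hε
    have h2 : ∀ᶠ n in atTop, dist (y (φ n)) x₀ < ε := Metric.tendsto_nhds.1 hlim ε hε
    obtain ⟨n, hn1, hn2⟩ := (h1.and h2).exists
    obtain ⟨w, hwL, hwd⟩ := hconf t ht (φ n) hn1
    refine ⟨w, hwL, ?_⟩
    calc dist x₀ w ≤ dist x₀ (y (φ n)) + dist (y (φ n)) w := dist_triangle _ _ _
      _ < ε + r t := by
          rw [dist_comm x₀, dist_comm (y (φ n)) w]
          exact add_lt_add_of_lt_of_le hn2 hwd
      _ = r t + ε := add_comm _ _
  have hne : (L t).Nonempty := by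
    obtain ⟨w, hw, -⟩ := hnear 1 one_pos
    exact ⟨w, hw⟩
  obtain ⟨w, hwL, hweq⟩ := (hL t ht).exists_infDist_eq_dist hne x₀
  refine ⟨w, hwL, ?_⟩
  rw [dist_comm, ← hweq]
  refine le_of_forall_pos_lt_add fun ε hε => ?_
  obtain ⟨w', hw'L, hw'd⟩ := hnear ε hε
  exact (infDist_le_dist_of_mem hw'L).trans_lt hw'd

/-! ## The composition (kernel-checked; sorries only through the six stubs) -/

/-- **COMPOSITION of the line `oseen-tail-calm-core-confinement`**: the six stubs imply the crux
`TypeICertificateLadder.TypeIConcentration` BY NAME, with `ρ_crux = ρ(C,c) + c/(2C₁(C))`,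
`γ = |B₁| c⁶/(64 C₁(C)³)`, `c = min c₀ (c_L/16)` (`c_L` = Leray's universal floor constant). -/
theorem TypeIConcentration_of :
    Summit.NavierStokesRegularity.NavierStokesRegularity.Theses.TypeICertificateLadder.TypeIConcentration := by
  intro C hC
  -- ### constants depending on `C` only
  obtain ⟨c₀, hc₀, hNN⟩ := stub_calmCoresPersist stub_oseenMajorantTail stub_shieldIntegral
  obtain ⟨cL, hcL, hLeray⟩ := leray_blowup_rate_top_holds
  set c : ℝ := min c₀ (cL / 16) with hc_def
  have hc0 : 0 < c := lt_min hc₀ (by positivity)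
  have hcc₀ : c ≤ c₀ := min_le_left _ _
  have hccL : 16 * c ≤ cL := by
    have h := min_le_right c₀ (cL / 16)
    linarith
  obtain ⟨ρ, hρ1, hP⟩ := hNN C hC c hc0 hcc₀
  have hρ0 : 0 < ρ := by linarith
  obtain ⟨C₁, hC₁, hG⟩ := stub_gradientUnderEnvelope C hC
  set V₁ : ℝ := (volume (Metric.ball (0 : EuclideanSpace ℝ (Fin 3)) 1)).toReal with hV₁
  have hV₁0 : 0 < V₁ :=
    ENNReal.toReal_pos (measure_ball_pos volume (0 : EuclideanSpace ℝ (Fin 3)) one_pos).ne'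
      measure_ball_lt_top.ne
  refine ⟨ρ + c / (2 * C₁), by positivity, V₁ * (c ^ 6 / (64 * C₁ ^ 3)), by positivity, ?_⟩
  intro ν T hν hT u p hcl hLH hdec hrate hext
  have hsν : 0 < Real.sqrt ν := Real.sqrt_pos.2 hν
  -- ### regularity of the slices
  have hcont : ∀ t ∈ Ico (0 : ℝ) T, Continuous (u t) := fun t ht =>
    (hcl.contDiff_velocity ht).continuous
  have hdiff : ∀ t ∈ Ico (0 : ℝ) T, Differentiable ℝ (u t) := fun t ht =>
    (hcl.contDiff_velocity ht).differentiable (by simp)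
  -- ### onset of the envelope: `tm`, then `t₁ = (tm+T)/2` (gradient window), `t₂ = (t₁+T)/2`
  obtain ⟨t₀, ht₀T, ht₀⟩ := mem_nhdsLT_iff_exists_Ioo_subset.1 hrate
  have ht₀T' : t₀ < T := ht₀T
  set tm : ℝ := max (T / 2) ((t₀ + T) / 2) with htm_def
  have htm0 : 0 ≤ tm := le_trans (by positivity) (le_max_left _ _)
  have htmT : tm < T := max_lt (by linarith) (by linarith)
  have htm₀ : t₀ < tm := lt_of_lt_of_le (by linarith) (le_max_right _ _)
  have henv : ∀ b : ℝ, tm ≤ b → ∀ s ∈ Ico b T, ∀ x, Real.sqrt (T - s) * ‖u s x‖ ≤ C * Real.sqrt ν :=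
    fun b hb s hs x => ht₀ ⟨by linarith [hs.1], hs.2⟩ x
  set t₁ : ℝ := (tm + T) / 2 with ht₁_def
  set t₂ : ℝ := (t₁ + T) / 2 with ht₂_def
  have ht₁m : tm < t₁ := by rw [ht₁_def]; linarith
  have ht₁T : t₁ < T := by rw [ht₁_def]; linarith
  have ht₂₁ : t₁ < t₂ := by rw [ht₂_def]; linarith
  have ht₂T : t₂ < T := by rw [ht₂_def]; linarith
  have ht₂m : tm ≤ t₂ := by linarith
  have ht₂0 : 0 ≤ t₂ := by linarith
  have hTt₂ : 0 < T - t₂ := sub_pos.2 ht₂T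
  -- gradient bound on `(t₁, T)`
  have hgrad : ∀ t ∈ Ioo t₁ T, ∀ x, (T - t) * ‖fderiv ℝ (u t) x‖ ≤ C₁ :=
    hG ν T tm hν hT htm0 htmT u p hcl hLH hdec (henv tm le_rfl)
  -- ### Leray's floor: loud points at every time (the one use of `¬ HasSmoothExtensionPast`)
  have hmax : IsMaximalSmoothSolution ν 0 u p T := ⟨hcl, hext⟩
  have hbdd : ∀ T' ∈ Ioo 0 T, eLpNorm (uncurry u) ∞
      ((volume : Measure (ℝ × EuclideanSpace ℝ (Fin 3))).restrict (Icc 0 T' ×ˢ univ)) < ∞ :=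
    eLpNorm_uncurry_top_lt_top_of_tao2011 tao2011_hasBoundedSobolevNormsOn_holds hν hcl hLH hdec
  have hfloor := hLeray ν T hν hT u p hmax hLH hbdd
  have hloud : ∀ s ∈ Ico (0 : ℝ) T, ∃ y : EuclideanSpace ℝ (Fin 3),
      cL / 2 * Real.sqrt ν < Real.sqrt (T - s) * ‖u s y‖ := by
    intro s hs
    by_contra hno
    push Not at hno
    have hTs : 0 < T - s := sub_pos.2 hs.2
    have hsq : 0 < Real.sqrt (T - s) := Real.sqrt_pos.2 hTs
    have hM : ∀ x, ‖u s x‖ ≤ cL / 2 * Real.sqrt ν / Real.sqrt (T - s) := by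
      intro x
      rw [le_div_iff₀ hsq]
      have h := hno x
      linarith [mul_comm (Real.sqrt (T - s)) ‖u s x‖]
    have h2 : eLpNorm (u s) ∞ volume ≤ ENNReal.ofReal (cL / 2 * Real.sqrt ν / Real.sqrt (T - s)) := by
      rw [eLpNorm_exponent_top]
      exact eLpNormEssSup_le_of_ae_bound (Eventually.of_forall hM)
    have hpos : 0 ≤ cL / 2 * Real.sqrt ν / Real.sqrt (T - s) := by positivity
    have h4 : cL * Real.sqrt ν / Real.sqrt (T - s) ≤ cL / 2 * Real.sqrt ν / Real.sqrt (T - s) :=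
      (ENNReal.ofReal_le_ofReal_iff hpos).1 ((hfloor s hs).trans h2)
    have h5 := mul_le_mul_of_nonneg_right h4 hsq.le
    rw [div_mul_cancel₀ _ hsq.ne', div_mul_cancel₀ _ hsq.ne'] at h5
    have hK : 0 < cL * Real.sqrt ν := mul_pos hcL hsν
    linarith
  -- ### the loud sequence `y n` at times `s n ↑ T`
  set s : ℕ → ℝ := fun n => T - (T - t₂) / 2 * (1 / ((n : ℝ) + 1)) with hs_def
  have hs_mem : ∀ n, s n ∈ Ioo t₂ T := by
    intro n
    have hn : (0 : ℝ) < (n : ℝ) + 1 := by positivity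
    have h1 : 0 < 1 / ((n : ℝ) + 1) := by positivity
    have h2 : 1 / ((n : ℝ) + 1) ≤ 1 := by
      rw [div_le_one hn]; linarith [show (0 : ℝ) ≤ n from n.cast_nonneg]
    constructor
    · show t₂ < T - (T - t₂) / 2 * (1 / ((n : ℝ) + 1))
      nlinarith
    · show T - (T - t₂) / 2 * (1 / ((n : ℝ) + 1)) < T
      nlinarith
  have hs_tend : Tendsto s atTop (𝓝 T) := by
    have h := (tendsto_one_div_add_atTop_nhds_zero_nat (𝕜 := ℝ)).const_mul ((T - t₂) / 2)
    rw [mul_zero] at h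
    have h2 : Tendsto (fun n : ℕ => T - (T - t₂) / 2 * (1 / ((n : ℝ) + 1))) atTop (𝓝 (T - 0)) :=
      tendsto_const_nhds.sub h
    rw [sub_zero] at h2
    exact h2
  have hs0 : ∀ n, s n ∈ Ico (0 : ℝ) T := fun n => ⟨ht₂0.trans (hs_mem n).1.le, (hs_mem n).2⟩
  choose y hy using fun n => hloud (s n) (hs0 n)
  -- ### confinement: the contrapositive of no-nucleation (`4c < c_L/2`)
  have hconf : ∀ b : ℝ, tm ≤ b → b < T → ∀ n, b ≤ s n →
      ∃ w ∈ closedBall (y n) (ρ * Real.sqrt (ν * (T - b))),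
        c * Real.sqrt ν < Real.sqrt (T - b) * ‖u b w‖ := by
    intro b hb hbT n hbn
    by_contra hno
    push Not at hno
    have hTb : 0 < T - b := sub_pos.2 hbT
    have h4 := hP ν T b hν hT (htm0.trans hb) hbT u p hcl hLH hdec (henv b hb) (y n) hno (s n)
      ⟨hbn, (hs_mem n).2⟩ (y n) (mem_closedBall_self (by positivity))
    have h5 := hy n
    nlinarith
  -- ### the loud sequence is bounded (far field of the slice `u t₂`)
  have hgt₂ : ∀ x, ‖fderiv ℝ (u t₂) x‖ ≤ C₁ / (T - t₂) := by
    intro x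
    rw [le_div_iff₀ hTt₂, mul_comm]
    exact hgrad t₂ ⟨ht₂₁, ht₂T⟩ x
  have hsq₂ : 0 < Real.sqrt (T - t₂) := Real.sqrt_pos.2 hTt₂
  obtain ⟨R, hR⟩ := stub_loudSetBounded (u t₂) (C₁ / (T - t₂)) (c * Real.sqrt ν / Real.sqrt (T - t₂))
    (by positivity) (hdiff t₂ ⟨ht₂0, ht₂T⟩) hgt₂ (hLH.memLp t₂ ⟨ht₂0, ht₂T.le⟩)
  have hybd : ∀ n, y n ∈ closedBall (0 : EuclideanSpace ℝ (Fin 3)) (R + ρ * Real.sqrt (ν * (T - t₂))) := by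
    intro n
    obtain ⟨w, hw, hwl⟩ := hconf t₂ ht₂m ht₂T n (hs_mem n).1.le
    have hwR : ‖w‖ ≤ R := by
      refine hR w ?_
      rw [div_le_iff₀ hsq₂]
      linarith [mul_comm (Real.sqrt (T - t₂)) ‖u t₂ w‖]
    rw [mem_closedBall, dist_zero_right]
    rw [mem_closedBall] at hw
    calc ‖y n‖ = dist (y n) 0 := (dist_zero_right _).symm
      _ ≤ dist (y n) w + dist w 0 := dist_triangle _ _ _
      _ ≤ ρ * Real.sqrt (ν * (T - t₂)) + R := by
          rw [dist_zero_right, dist_comm]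
          exact add_le_add hw hwR
      _ = R + ρ * Real.sqrt (ν * (T - t₂)) := add_comm _ _
  -- ### pin one centre
  have hLclosed : ∀ t ∈ Ioo t₂ T,
      IsClosed {w : EuclideanSpace ℝ (Fin 3) | c * Real.sqrt ν ≤ Real.sqrt (T - t) * ‖u t w‖} := by
    intro t ht
    exact isClosed_le continuous_const
      (continuous_const.mul (hcont t ⟨ht₂0.trans ht.1.le, ht.2⟩).norm)
  have hconf' : ∀ t ∈ Ioo t₂ T, ∀ n, t ≤ s n →
      ∃ w ∈ {w : EuclideanSpace ℝ (Fin 3) | c * Real.sqrt ν ≤ Real.sqrt (T - t) * ‖u t w‖},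
        dist w (y n) ≤ ρ * Real.sqrt (ν * (T - t)) := by
    intro t ht n hn
    obtain ⟨w, hw, hwl⟩ := hconf t (ht₂m.trans ht.1.le) ht.2 n hn
    exact ⟨w, le_of_lt hwl, mem_closedBall.1 hw⟩
  obtain ⟨x₀, hx₀⟩ := exists_centre_of_confinement hs_tend hybd
    (fun t => {w : EuclideanSpace ℝ (Fin 3) | c * Real.sqrt ν ≤ Real.sqrt (T - t) * ‖u t w‖}) hLclosed
    (fun t => ρ * Real.sqrt (ν * (T - t))) hconf'
  -- ### the mass at every late time
  refine ⟨x₀, ?_⟩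
  filter_upwards [Ioo_mem_nhdsLT ht₂T] with t ht
  obtain ⟨w, hwl, hwd⟩ := hx₀ t ht
  have ht0 : t ∈ Ico (0 : ℝ) T := ⟨ht₂0.trans ht.1.le, ht.2⟩
  have hgt : ∀ x, (T - t) * ‖fderiv ℝ (u t) x‖ ≤ C₁ := hgrad t ⟨ht₂₁.trans ht.1, ht.2⟩
  have hmass := stub_loudPointMass c C₁ ν T t hc0 hC₁ hν ht.2 (u t) (hdiff t ht0) hgt w hwl
  refine hmass.trans ?_
  have hint : IntegrableOn (fun x => ‖u t x‖ ^ 3)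
      (closedBall x₀ ((ρ + c / (2 * C₁)) * Real.sqrt (ν * (T - t)))) volume :=
    (((hcont t ht0).norm.pow 3).continuousOn).integrableOn_compact (isCompact_closedBall _ _)
  refine setIntegral_mono_set (hint.mono_set ball_subset_closedBall)
    (ae_of_all _ fun x => by positivity)
    ((show (Metric.ball w (c / (2 * C₁) * Real.sqrt (ν * (T - t))) : Set (EuclideanSpace ℝ (Fin 3))) ≤
        Metric.ball x₀ ((ρ + c / (2 * C₁)) * Real.sqrt (ν * (T - t))) from ball_subset_ball' ?_).eventuallyLE)
  have hr0 : 0 ≤ Real.sqrt (ν * (T - t)) := Real.sqrt_nonneg _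
  calc c / (2 * C₁) * Real.sqrt (ν * (T - t)) + dist w x₀
      ≤ c / (2 * C₁) * Real.sqrt (ν * (T - t)) + ρ * Real.sqrt (ν * (T - t)) := by linarith [hwd]
    _ = (ρ + c / (2 * C₁)) * Real.sqrt (ν * (T - t)) := by ring

end Summit.NavierStokesRegularity.NavierStokesRegularity.Cruxes.TypeIConcentration.OseenTailCalmCoreConfinement

end
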